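import Summits.QuantumFields.GaugeBoot.PlanarBootstrapStrongCouplingLargeN
import HarnessLib

/-!
# The `1/N²` law: at strong 't Hooft coupling a planar certificate holds for `SU(N)` up to `K/N²` — modulo Shen–Zhu–Zhu's variance bound (gauge-boot, large-`N` supplement 9)

HONEST FRAMING (cell `pub-gaugeboot`, page 1 of every file): the venture produces certified bounds
on lattice expectations at stated coupling, gauge group, dimension and torus size; NOT a mass gap,
NOT a continuum limit, NOT a string tension; NOT large `N` unless marked CONDITIONAL; NOT
Yang–Mills-summit-bearing (barriers `FixedCouplingUltralocality`, `PerturbativeInvisibility`).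
CONDITIONAL on the tree's named fact `shenZhuZhu_largeN_variance` (SZZ CMP 400 (2023) Cor. 1.5
(1.12), a published theorem typed as a hypothesis); the constant `K` is explicit but not optimised;
no planar certificate of the cell exists in the tree; this file certifies no number.

## Content

Supplement 6 gave the qualitative statement (`obj ≤ bound + δ` eventually).  SZZ's bound is
quantitative — `Var(W_ℓ/N) ≤ 4 n(n−3)/(K_𝒮 N)` with `K_𝒮 = N (1/2 − 8|βt|(d−1))` — so every defect
of supplement 4 is `O(1/N²)`:

* `abs_loopImCov_le_half_add` — `|Γ(A,B)| ≤ (Γ(A,A) + Γ(B,B))/2` (any probability state);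
* `loopImCov_le_of_szz` — `Γ_{μ_N}(C, C) ≤ 4 n_γ(n_γ−3) / (c₀ N²)`, `c₀ = 1/2 − 8|βt|(d−1)`
  (`szzPlanarSlope`), for a word realised by a non-backtracking closed walk `γ`, `μ_N` a limit point;
* `shorDefect_le_of_szz`, `rowDefectSuN_le_of_szz` — the relaxation and row defects are `≤ ·/N²`;
* ★★★ `PlanarCertificate.obj_le_bound_add_div_sq_of_szz` — **GIVEN SZZ (1.12), `d ≥ 2`,
  `|βt| < 1/(16(d−1))`: for a valid planar certificate whose relaxation loops, marked words and the
  plaquette words of its rows are realised by non-backtracking closed walks, there is an explicit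
  `K` (depending only on the certificate, the walks, `d`, `βt`) with
  `obj(W_{μ_N}) ≤ bound + K/N²` for EVERY `N ≥ 1` and EVERY thermodynamic limit point `μ_N` of the
  `SU(N)` torus Wilson states at tree coupling `N·βt` satisfying the identification rows** — the
  "`1/N²` corrections to the planar limit" of the physics literature, here as a one-sided theorem for
  certified planar bounds (`PlanarCertificate.szzRateConst` is the `K`).

[folklore] bookkeeping on top of SZZ; Kazakov–Zheng arXiv:2203.11360; 't Hooft 1974.
-/

noncomputable section

open MeasureTheory ProbabilityTheory Filter Topology
open scoped BigOperators
open Literature.Probability.LatticeModels (Site zdGraph)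
open Literature.MathematicalPhysics.QuantumLattice
open Literature.MathematicalPhysics.QuantumFieldTheory (szzThresholdSU szzBakryEmeryConstSU szzBakryEmeryConstSU_eq
  shenZhuZhu_largeN_variance IsNonBacktrackingLoop wilsonLoopTrace wilsonLoopTrace_apply)

namespace Summit.QuantumFields.GaugeBoot

variable {d N : ℕ}

/-! ## `|Γ(A,B)| ≤ (Γ(A,A) + Γ(B,B))/2` -/

/-- `|Γ(A, B)| ≤ (Γ(A, A) + Γ(B, B))/2` (`2|ab| ≤ a² + b²` integrated). [folklore] -/
theorem abs_loopImCov_le_half_add {G : Type*} [Group G] [TopologicalSpace G] [IsTopologicalGroup G] [CompactSpace G]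
    [MeasurableSpace G] [BorelSpace G] (ρ : G →* Matrix (Fin N) (Fin N) ℂ) (hρ : Continuous ρ)
    (μ : Measure (LGConfig d G)) [IsProbabilityMeasure μ] (x : Site d) (A B : Word d) :
    |loopImCov ρ μ x A B| ≤ (loopImCov ρ μ x A A + loopImCov ρ μ x B B) / 2 := by
  rw [loopImCov, loopImCov_self_eq, loopImCov_self_eq]
  have hiA : Integrable (fun U => (loopTrZd ρ x A U).im ^ 2) μ :=
    integrable_sq_im (aestronglyMeasurable_loopTrZd ρ hρ μ x A) (norm_loopTrZd_le_one ρ hρ x A)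
  have hiB : Integrable (fun U => (loopTrZd ρ x B U).im ^ 2) μ :=
    integrable_sq_im (aestronglyMeasurable_loopTrZd ρ hρ μ x B) (norm_loopTrZd_le_one ρ hρ x B)
  have hiAB := integrable_im_mul_im ρ hρ μ x A B
  rw [abs_le]
  constructor
  · -- `-(a²+b²)/2 ≤ ab`
    have h : ∫ U, -(((loopTrZd ρ x A U).im ^ 2 + (loopTrZd ρ x B U).im ^ 2) / 2) ∂μ ≤
        ∫ U, (loopTrZd ρ x A U).im * (loopTrZd ρ x B U).im ∂μ :=
      integral_mono ((hiA.add hiB).div_const 2).neg hiAB fun U => by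
        have := sq_nonneg ((loopTrZd ρ x A U).im + (loopTrZd ρ x B U).im)
        simp only; nlinarith
    rw [integral_neg, integral_div, integral_add hiA hiB] at h
    linarith
  · have h : ∫ U, (loopTrZd ρ x A U).im * (loopTrZd ρ x B U).im ∂μ ≤
        ∫ U, ((loopTrZd ρ x A U).im ^ 2 + (loopTrZd ρ x B U).im ^ 2) / 2 ∂μ :=
      integral_mono hiAB ((hiA.add hiB).div_const 2) fun U => by
        have := sq_nonneg ((loopTrZd ρ x A U).im - (loopTrZd ρ x B U).im)
        simp only; nlinarith
    rw [integral_div, integral_add hiA hiB] at h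
    exact h

/-! ## The quantitative SZZ bound: `Γ_{μ_N}(C,C) ≤ 4 n(n−3)/(c₀ N²)` -/

/-- The slope `c₀ = 1/2 − 8|βt|(d−1)` of SZZ's Bakry–Émery constant `K_𝒮 = N c₀` for `SU(N)`.
[cite: ShenZhuZhuCMP2023, Assumption 1.1] -/
def szzPlanarSlope (d : ℕ) (βt : ℝ) : ℝ := 1 / 2 - 8 * |βt| * ((d : ℝ) - 1)

/-- `c₀ > 0` under SZZ's threshold `|βt| < 1/(16(d−1))`, `d ≥ 2`. [cite: ShenZhuZhuCMP2023, (1.3)] -/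
theorem szzPlanarSlope_pos (hd : 2 ≤ d) {βt : ℝ} (hβ : |βt| < szzThresholdSU d) : 0 < szzPlanarSlope d βt := by
  have hd' : (0 : ℝ) < (d : ℝ) - 1 := by
    have : (2 : ℝ) ≤ d := by exact_mod_cast hd
    linarith
  rw [szzThresholdSU, lt_div_iff₀ (by positivity)] at hβ
  rw [szzPlanarSlope]
  nlinarith [abs_nonneg βt]

/-- `K_𝒮(N) = N · c₀`. [cite: ShenZhuZhuCMP2023, Assumption 1.1] -/
theorem szzBakryEmeryConstSU_eq_mul_slope (N d : ℕ) (βt : ℝ) :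
    szzBakryEmeryConstSU N d βt = N * szzPlanarSlope d βt := by
  rw [szzBakryEmeryConstSU_eq, szzPlanarSlope]; ring

/-- ★★ **The quantitative concentration**: GIVEN SZZ (1.12), for `d ≥ 2`, `|βt| < 1/(16(d−1))`,
`N ≥ 1`, a thermodynamic limit point `μ` of the `SU(N)` torus Wilson states at tree coupling `N·βt`,
and a word `C` realised by a non-backtracking closed walk `γ` at `x`:
`Γ_μ(C, C) ≤ 4 n_γ(n_γ − 3) / (c₀ N²)`. [cite: ShenZhuZhuCMP2023, Corollary 1.5] -/
theorem loopImCov_le_of_szz (hfact : ∀ N, shenZhuZhu_largeN_variance d N) (hd : 2 ≤ d) {βt : ℝ}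
    (hβ : |βt| < szzThresholdSU d) (hN : 1 ≤ N) {μ : Measure (LGConfig d (Matrix.specialUnitaryGroup (Fin N) ℂ))}
    (hμ : μ ∈ infiniteVolumeLimitPoints (d := d) (fundamentalRep (Fin N)) ((N : ℝ) * βt))
    (x : Site d) (C : Word d) (γ : (zdGraph d).Walk x x) (hγ : IsNonBacktrackingLoop γ)
    (hhol : ∀ U : LGConfig d (Matrix.specialUnitaryGroup (Fin N) ℂ), walkHolonomy U γ = wordHolonomyZd U x C) :
    loopImCov (fundamentalRep (Fin N)) μ x C C ≤
      4 * ((γ.length : ℝ) * ((γ.length : ℝ) - 3)) / szzPlanarSlope d βt / (N : ℝ) ^ 2 := by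
  haveI : IsProbabilityMeasure μ := by obtain ⟨L, -, hL⟩ := hμ; exact hL.1
  have hvar := (hfact N).1 hd hN βt hβ μ hμ x γ hγ
  have h0 := integral_im_loopTrZd_eq_zero_of_mem_infiniteVolumeLimitPoints hμ x C
  rw [loopImCov_self_eq_variance _ (continuous_fundamentalRep (Fin N)) μ x C h0]
  have hfun : (fun U : LGConfig d (Matrix.specialUnitaryGroup (Fin N) ℂ) => (loopTrZd (fundamentalRep (Fin N)) x C U).im) =
      fun U => (wilsonLoopTrace (fundamentalRep (Fin N)) γ U).im / N := by
    funext U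
    rw [loopTrZd_apply, Complex.div_natCast_im, wilsonLoopTrace_apply, hhol U]
  rw [hfun]
  refine (le_add_of_nonneg_left (variance_nonneg _ _)).trans (hvar.trans (le_of_eq ?_))
  have hc : 0 < szzPlanarSlope d βt := szzPlanarSlope_pos hd hβ
  have hN' : (0 : ℝ) < N := by exact_mod_cast hN
  rw [szzBakryEmeryConstSU_eq_mul_slope]
  field_simp

/-! ## The defects are `O(1/N²)` -/

namespace PlanarCertificate

variable (P : PlanarCertificate d)

/-- The relaxation defect is `O(1/N²)`: `γ_s(μ_N) ≤ (nI Σ_A m_{sA}² · 4 n_A(n_A−3)/c₀) / N²`.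
[cite: ShenZhuZhuCMP2023, Corollary 1.5] -/
theorem shorDefect_le_of_szz (hfact : ∀ N, shenZhuZhu_largeN_variance d N) (hd : 2 ≤ d)
    (hβ : |P.βt| < szzThresholdSU d) (hN : 1 ≤ N) {μ : Measure (LGConfig d (Matrix.specialUnitaryGroup (Fin N) ℂ))}
    (hμ : μ ∈ infiniteVolumeLimitPoints (d := d) (fundamentalRep (Fin N)) ((N : ℝ) * P.βt)) (x : Site d)
    (γS : (A : Fin P.nI) → (zdGraph d).Walk x x) (hγS : ∀ A, IsNonBacktrackingLoop (γS A))
    (hholS : ∀ A (U : LGConfig d (Matrix.specialUnitaryGroup (Fin N) ℂ)), walkHolonomy U (γS A) = wordHolonomyZd U x (P.shorLoop A))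
    (s : Fin P.nS) :
    P.shorDefect (fundamentalRep (Fin N)) μ x s ≤
      ((P.nI : ℝ) * ∑ A, P.shorVec s A ^ 2 * (4 * (((γS A).length : ℝ) * (((γS A).length : ℝ) - 3)) / szzPlanarSlope d P.βt)) /
        (N : ℝ) ^ 2 := by
  haveI : IsProbabilityMeasure μ := by obtain ⟨L, -, hL⟩ := hμ; exact hL.1
  refine (P.shorDefect_le_card _ (continuous_fundamentalRep (Fin N)) μ x s).trans ?_
  rw [mul_div_assoc, Finset.sum_div]
  gcongr with A
  rw [mul_div_assoc]
  gcongr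
  exact loopImCov_le_of_szz hfact hd hβ hN hμ x _ (γS A) (hγS A) (hholS A)

/-- The `SU(N)` row defect is `O(1/N²)`:
`ε_r(μ_N) ≤ (length(w_r) + |βt| Σ_{ν,ε} (2 n_r(n_r−3) + 2 n_{P̃}(n_{P̃}−3))/c₀) / N²`.
[cite: ShenZhuZhuCMP2023, Corollary 1.5] -/
theorem rowDefectSuN_le_of_szz (hfact : ∀ N, shenZhuZhu_largeN_variance d N) (hd : 2 ≤ d)
    (hβ : |P.βt| < szzThresholdSU d) (hN : 1 ≤ N) {μ : Measure (LGConfig d (Matrix.specialUnitaryGroup (Fin N) ℂ))}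
    (hμ : μ ∈ infiniteVolumeLimitPoints (d := d) (fundamentalRep (Fin N)) ((N : ℝ) * P.βt)) (x : Site d)
    (γR : (r : Fin P.nR) → (zdGraph d).Walk x x) (hγR : ∀ r, IsNonBacktrackingLoop (γR r))
    (hholR : ∀ r (U : LGConfig d (Matrix.specialUnitaryGroup (Fin N) ℂ)), walkHolonomy U (γR r) = wordHolonomyZd U x (P.rowWord r))
    (γP : (r : Fin P.nR) → Fin d → Bool → (zdGraph d).Walk x x) (hγP : ∀ r ν ε, IsNonBacktrackingLoop (γP r ν ε))
    (hholP : ∀ r ν ε (U : LGConfig d (Matrix.specialUnitaryGroup (Fin N) ℂ)),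
      walkHolonomy U (γP r ν ε) = wordHolonomyZd U x (plaqWord (P.rowAxis r) ν ε))
    (r : Fin P.nR) :
    P.rowDefectSuN μ x r ≤
      (((P.rowWord r).length : ℝ) + |P.βt| * ∑ ν ∈ Finset.univ.erase (P.rowAxis r), ∑ ε : Bool,
        (2 * (((γR r).length : ℝ) * (((γR r).length : ℝ) - 3)) +
          2 * (((γP r ν ε).length : ℝ) * (((γP r ν ε).length : ℝ) - 3))) / szzPlanarSlope d P.βt) / (N : ℝ) ^ 2 := by
  haveI : IsProbabilityMeasure μ := by obtain ⟨L, -, hL⟩ := hμ; exact hL.1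
  have hww := loopImCov_le_of_szz hfact hd hβ hN hμ x _ (γR r) (hγR r) (hholR r)
  rw [rowDefectSuN, add_div, mul_div_assoc, Finset.sum_div]
  gcongr with ν _
  rw [Finset.sum_div]
  gcongr with ε _
  have hPP := loopImCov_le_of_szz hfact hd hβ hN hμ x _ (γP r ν ε) (hγP r ν ε) (hholP r ν ε)
  refine (abs_loopImCov_le_half_add _ (continuous_fundamentalRep (Fin N)) μ x _ _).trans ?_
  rw [div_le_iff₀ (by norm_num : (0 : ℝ) < 2)]
  have hc : 0 < szzPlanarSlope d P.βt := szzPlanarSlope_pos hd hβ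
  have hNpos : (0 : ℝ) < N := by exact_mod_cast hN
  calc loopImCov (fundamentalRep (Fin N)) μ x (P.rowWord r) (P.rowWord r) +
        loopImCov (fundamentalRep (Fin N)) μ x (plaqWord (P.rowAxis r) ν ε) (plaqWord (P.rowAxis r) ν ε)
      ≤ 4 * (((γR r).length : ℝ) * (((γR r).length : ℝ) - 3)) / szzPlanarSlope d P.βt / (N : ℝ) ^ 2 +
          4 * (((γP r ν ε).length : ℝ) * (((γP r ν ε).length : ℝ) - 3)) / szzPlanarSlope d P.βt / (N : ℝ) ^ 2 :=
        add_le_add hww hPP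
    _ = _ := by field_simp; ring

/-- **The explicit `1/N²` constant** `K` of the rate theorem (certificate data, walk lengths, `c₀`). [folklore] -/
def szzRateConst (x : Site d) (γS : (A : Fin P.nI) → (zdGraph d).Walk x x) (γR : (r : Fin P.nR) → (zdGraph d).Walk x x)
    (γP : (r : Fin P.nR) → Fin d → Bool → (zdGraph d).Walk x x) : ℝ :=
  (∑ r, |P.rowMult r| * (((P.rowWord r).length : ℝ) + |P.βt| * ∑ ν ∈ Finset.univ.erase (P.rowAxis r), ∑ ε : Bool,
      (2 * (((γR r).length : ℝ) * (((γR r).length : ℝ) - 3)) +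
        2 * (((γP r ν ε).length : ℝ) * (((γP r ν ε).length : ℝ) - 3))) / szzPlanarSlope d P.βt)) +
    ∑ s, (P.nI : ℝ) * ∑ A, P.shorVec s A ^ 2 * (4 * (((γS A).length : ℝ) * (((γS A).length : ℝ) - 3)) / szzPlanarSlope d P.βt)

/-- ★★★ **THE `1/N²` LAW (given SZZ (1.12)).**  `d ≥ 2`, `|βt| < 1/(16(d−1))`; `P` a valid planar
certificate at `βt`; its relaxation loops `ℓ_A`, marked words `w_r` and the plaquette words
`P̃_{a_r,ν,ε}` of its rows realised by non-backtracking closed walks at `x` (Gram words and rows closed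
at `x`); `μ_N` (`N ≥ 1`) ANY thermodynamic limit point of the `SU(N)` torus Wilson states at tree
coupling `N·βt` satisfying the identification rows.  Then for every `N ≥ 1`:
`obj(W_{μ_N}) ≤ bound + K / N²` with the explicit `K = szzRateConst`. [cite: ShenZhuZhuCMP2023, Corollary 1.5] -/
theorem obj_le_bound_add_div_sq_of_szz (hP : P.IsValid) (hfact : ∀ N, shenZhuZhu_largeN_variance d N)
    (hd : 2 ≤ d) (hβ : |P.βt| < szzThresholdSU d) (hN : 1 ≤ N)
    {μ : Measure (LGConfig d (Matrix.specialUnitaryGroup (Fin N) ℂ))}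
    (hμ : μ ∈ infiniteVolumeLimitPoints (d := d) (fundamentalRep (Fin N)) ((N : ℝ) * P.βt)) (x : Site d)
    (hrow : ∀ r, Word.endpointZd x (P.rowWord r) = x) (hgram : ∀ j i, Word.endpointZd x (P.gramWord j i) = x)
    (hlin : ∀ e, P.lin e (loopW (fundamentalRep (Fin N)) μ x) (loopQ (fundamentalRep (Fin N)) μ x) = 0)
    (γS : (A : Fin P.nI) → (zdGraph d).Walk x x) (hγS : ∀ A, IsNonBacktrackingLoop (γS A))
    (hholS : ∀ A (U : LGConfig d (Matrix.specialUnitaryGroup (Fin N) ℂ)), walkHolonomy U (γS A) = wordHolonomyZd U x (P.shorLoop A))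
    (γR : (r : Fin P.nR) → (zdGraph d).Walk x x) (hγR : ∀ r, IsNonBacktrackingLoop (γR r))
    (hholR : ∀ r (U : LGConfig d (Matrix.specialUnitaryGroup (Fin N) ℂ)), walkHolonomy U (γR r) = wordHolonomyZd U x (P.rowWord r))
    (γP : (r : Fin P.nR) → Fin d → Bool → (zdGraph d).Walk x x) (hγP : ∀ r ν ε, IsNonBacktrackingLoop (γP r ν ε))
    (hholP : ∀ r ν ε (U : LGConfig d (Matrix.specialUnitaryGroup (Fin N) ℂ)),
      walkHolonomy U (γP r ν ε) = wordHolonomyZd U x (plaqWord (P.rowAxis r) ν ε)) :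
    P.obj (loopW (fundamentalRep (Fin N)) μ x) ≤ P.bound + P.szzRateConst x γS γR γP / (N : ℝ) ^ 2 := by
  haveI : SecondCountableTopology (Matrix (Fin N) (Fin N) ℂ) :=
    inferInstanceAs (SecondCountableTopology (Fin N → Fin N → ℂ))
  haveI : SecondCountableTopology (Matrix.specialUnitaryGroup (Fin N) ℂ) :=
    Topology.IsEmbedding.subtypeVal.secondCountableTopology
  have hβ' : (N : ℝ) * P.βt / N = P.βt := natCast_mul_div_natCast hN P.βt
  have h := P.obj_loopW_le_suN_of_mem_infiniteVolumeLimitPoints hP hβ' hμ x hrow hgram hlin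
  refine h.trans ?_
  rw [add_assoc, szzRateConst, add_div, Finset.sum_div, Finset.sum_div]
  gcongr with r _ s _
  · rw [mul_div_assoc]
    gcongr
    exact P.rowDefectSuN_le_of_szz hfact hd hβ hN hμ x γR hγR hholR γP hγP hholP r
  · exact P.shorDefect_le_of_szz hfact hd hβ hN hμ x γS hγS hholS s

end PlanarCertificate

end Summit.QuantumFields.GaugeBoot

end

/-! ## Erratum on the hypotheses (2026-08-31, lean3 gen 86)

`PlanarCertificate.rowDefectSuN_le_of_szz`, `PlanarCertificate.szzRateConst` and
`PlanarCertificate.obj_le_bound_add_div_sq_of_szz` above take walk data `γP r ν ε` — a non-backtracking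
closed walk with the holonomy of `plaqWord (P.rowAxis r) ν ε` — for EVERY axis `ν : Fin d`, including
`ν = P.rowAxis r`, although the rows only sum over `ν ≠ P.rowAxis r`.  For `ν = a` the word
`plaqWord a a ε = [a, a, a⁻¹, a⁻¹]` (resp. `[a, a⁻¹, a⁻¹, a]`) has holonomy identically `1`, while a
non-backtracking closed walk is a reduced edge word and has, over `SU(N)` with `N ≥ 2` (which contains
free subgroups), a configuration with non-trivial holonomy: so for `N ≥ 2` the hypothesis `hholP r a ε`
cannot be supplied, and the three statements, while true, are idle for certificates with at least one
row.  The intended statements — the same conclusions WITHOUT any plaquette-walk data (the plaquette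
words `ν ≠ a` are realised by `PlanarPlaquetteWalks`) — are
`PlanarCertificate.rowDefectSuN_le_of_szz'`, `PlanarCertificate.szzRateConst'`,
`PlanarCertificate.obj_le_bound_add_div_sq_of_szz'` and the decidable-side-condition form
`PlanarCertificate.obj_le_bound_add_div_sq_of_szz_of_cyclicallyReduced` of
`PlanarBootstrapLargeNRateWords.lean`; cite those.  `abs_loopImCov_le_half_add`, `szzPlanarSlope`,
`loopImCov_le_of_szz` and `PlanarCertificate.shorDefect_le_of_szz` above are unaffected. -/
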